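import Summits.KontsevichZagierPeriods.KontsevichZagierPeriods.Theorems.KzOnePeriodsG0DerivLogSegment

/-!
# KontsevichZagierPeriods — kz1p (R1)–(R5) derivations, part 2: input forms on `Z_a` and segment symbols

Cell pub-kz1p, seat b2b-kz1p-2, gen 12 (kz1p v1.3; PROCEDURE.md §4d; LEAN-IN-TREE rule).  [cite: HuberWustholz2022, §13.1 (p. 120)];
no named facts, no `sorry`.

kz1p's input 1-form `Σ_c r_c dx/(x − a_c) + p(x) dx` on `Z_a = {y ∏ᵢ (x − aᵢ) = 1}` as a polynomial form
(`inputForm`), its `ℚ̄`-coefficients, the segment paths on `Z_a` (`exists_segPath`), and the reduction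
`span_segmentSymbol`: (R1) split + (R3) exact part + (R4) to `𝔾ₘ` + the principal logarithm (part 1).
-/

noncomputable section

open scoped BigOperators Real
open MvPolynomial Set Complex
open Literature.NumberTheory.Transcendental
open Literature.NumberTheory.Transcendental.CurvePeriods

namespace Summit.KontsevichZagierPeriods.KzOnePeriods.G0Derivation

local notation3 "InSpanRel " c:arg => ∃ (k : ℕ) (ρ : Fin k → (PeriodSymbol →₀ ℂ))
  (a : Fin k → ℂ), (∀ l, IsElementaryRelation (ρ l)) ∧ (∀ l, IsAlgebraic ℚ (a l)) ∧
    c = ∑ l, a l • ρ l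

local notation3 (prettyPrint := false) "𝔾m" => (⟨2, 1, ![X 0 * X 1 - 1]⟩ : CurveData)

local notation3 "logSym " E:arg => (⟨⟨2, 1, ![X 0 * X 1 - 1]⟩, isSmoothAffineCurve_mulGroup,
  ![X 1, 0], hasAlgCoeffs_ydx, E⟩ : PeriodSymbol)

/-! ### kz1p input forms on the punctured line `Z_a`

kz1p's input 1-form `Σ_c r_c dx/(x − a_c) + p(x) dx` (simple poles `a_c`, residue coefficients
`r_c`, polynomial part `p(x) = Σ_k p_k x^k`, all in the number field `K ⊂ ℚ̄`) is written on
`Z_a = {y ∏ᵢ (x − aᵢ) = 1}` (where `1/(x − a_c) = y ∏_{j ≠ c} (x − a_j)`) as the polynomial form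
`Σ_c r_c · y ∏_{j≠c}(x − a_j) dx + dP`, `P(x) = Σ_k p_k x^{k+1}/(k+1)` (so `dP = p(x) dx`). -/

section InputForms

variable {r : ℕ}

local notation3 (prettyPrint := false) "ZP " a:arg =>
  (⟨2, 1, ![X 1 * ∏ i, (X 0 - C (a i)) - 1]⟩ : CurveData)

/-- The polynomial part `p(x) = Σ_k p_k x^k ∈ ℂ[x, y]`. -/
def polyPart {d : ℕ} (pc : Fin d → ℂ) : MvPolynomial (Fin 2) ℂ :=
  ∑ k : Fin d, C (pc k) * X 0 ^ (k : ℕ)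

/-- Its primitive `P(x) = Σ_k p_k x^{k+1}/(k+1) ∈ ℂ[x, y]`. -/
def polyPrim {d : ℕ} (pc : Fin d → ℂ) : MvPolynomial (Fin 2) ℂ :=
  ∑ k : Fin d, C (pc k / ((k : ℕ) + 1)) * X 0 ^ ((k : ℕ) + 1)

/-- The value `P(z) = Σ_k p_k z^{k+1}/(k+1)`. -/
def polyPrimVal {d : ℕ} (pc : Fin d → ℂ) (z : ℂ) : ℂ :=
  ∑ k : Fin d, pc k / ((k : ℕ) + 1) * z ^ ((k : ℕ) + 1)

/-- **kz1p input form** `Σ_c r_c · y ∏_{j≠c}(x − a_j) dx + dP` on `Z_a`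
(`= Σ_c r_c dx/(x − a_c) + p(x) dx` on `Z_a`, see `eval_inputForm_zero`). -/
def inputForm (a : Fin r → ℂ) (rc : Fin r → ℂ) {d : ℕ} (pc : Fin d → ℂ) :
    Fin 2 → MvPolynomial (Fin 2) ℂ :=
  ∑ i, rc i • (![X 1 * ∏ j ∈ Finset.univ.erase i, (X 0 - C (a j)), 0] :
    Fin 2 → MvPolynomial (Fin 2) ℂ) + formD (polyPrim pc)

/-- `dP = p(x) dx`. [folklore] -/
theorem formD_polyPrim {d : ℕ} (pc : Fin d → ℂ) : formD (polyPrim pc) = ![polyPart pc, 0] := by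
  funext i
  fin_cases i
  · simp only [formD, polyPrim, polyPart, Fin.zero_eta, Matrix.cons_val_zero, map_sum]
    refine Finset.sum_congr rfl fun k _ => ?_
    rw [pderiv_C_mul, pderiv_pow, pderiv_X_self, mul_one, Nat.add_sub_cancel, ← mul_assoc]
    congr 1
    have hk : ((k : ℕ) + 1 : ℂ) ≠ 0 := Nat.cast_add_one_ne_zero _
    rw [show ((((k : ℕ) + 1 : ℕ) : MvPolynomial (Fin 2) ℂ)) = C (((k : ℕ) : ℂ) + 1) by simp,
      ← C_mul, div_mul_cancel₀ _ hk]
  · simp only [formD, polyPrim, Fin.mk_one, Matrix.cons_val_one, Matrix.cons_val_fin_one, map_sum]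
    refine Finset.sum_eq_zero fun k _ => ?_
    rw [pderiv_C_mul, pderiv_pow, pderiv_X_of_ne (by decide : (0 : Fin 2) ≠ 1), mul_zero, mul_zero]

/-- The `dx`-component of the input form: `Σ_c r_c · y ∏_{j≠c}(x − a_j) + p(x)`. [folklore] -/
theorem inputForm_zero (a : Fin r → ℂ) (rc : Fin r → ℂ) {d : ℕ} (pc : Fin d → ℂ) :
    inputForm a rc pc 0 = ∑ i, rc i • (X 1 * ∏ j ∈ Finset.univ.erase i, (X 0 - C (a j))) +
      polyPart pc := by
  simp only [inputForm, formD_polyPrim, Pi.add_apply, Finset.sum_apply, Pi.smul_apply,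
    Matrix.cons_val_zero]

/-- The `dy`-component of the input form is `0`. [folklore] -/
theorem inputForm_one (a : Fin r → ℂ) (rc : Fin r → ℂ) {d : ℕ} (pc : Fin d → ℂ) :
    inputForm a rc pc 1 = 0 := by
  simp only [inputForm, formD_polyPrim, Pi.add_apply, Finset.sum_apply, Pi.smul_apply,
    Matrix.cons_val_one, Matrix.cons_val_fin_one, smul_zero, Finset.sum_const_zero, add_zero]

/-- **On `Z_a` the input form is the rational form `(Σ_c r_c/(x − a_c) + p(x)) dx`.** [folklore] -/
theorem eval_inputForm_zero (a : Fin r → ℂ) (rc : Fin r → ℂ) {d : ℕ} (pc : Fin d → ℂ)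
    {z : Fin 2 → ℂ} (hz : z ∈ (ZP a).points) (h0 : ∀ i, z 0 ≠ a i) :
    eval z (inputForm a rc pc 0) = ∑ i, rc i / (z 0 - a i) + ∑ k : Fin d, pc k * z 0 ^ (k : ℕ) := by
  classical
  rw [mem_points_puncturedLine_iff] at hz
  rw [inputForm_zero, map_add, map_sum]
  congr 1
  · refine Finset.sum_congr rfl fun i _ => ?_
    rw [smul_eq_C_mul, map_mul, eval_C, map_mul, eval_X, map_prod]
    have e : ∏ j ∈ Finset.univ.erase i, eval z (X 0 - C (a j)) = ∏ j ∈ Finset.univ.erase i, (z 0 - a j) :=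
      Finset.prod_congr rfl fun j _ => by simp
    rw [e, div_eq_mul_inv]
    congr 1
    have hp : (z 0 - a i) * ∏ j ∈ Finset.univ.erase i, (z 0 - a j) = ∏ j, (z 0 - a j) :=
      Finset.mul_prod_erase (s := Finset.univ) (f := fun j => z 0 - a j) (Finset.mem_univ i)
    have hne : z 0 - a i ≠ 0 := sub_ne_zero.2 (h0 i)
    refine eq_inv_of_mul_eq_one_left ?_
    rw [← hz, ← hp]
    ring
  · simp only [polyPart, map_sum, map_mul, eval_C, map_pow, eval_X]

/-- `P` evaluates through the first coordinate. [folklore] -/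
theorem eval_polyPrim {d : ℕ} (pc : Fin d → ℂ) (z : Fin 2 → ℂ) :
    eval z (polyPrim pc) = polyPrimVal pc (z 0) := by
  simp only [polyPrim, polyPrimVal, map_sum, map_mul, eval_C, map_pow, eval_X]

/-- `P` has algebraic coefficients. [folklore] -/
theorem hasAlgCoeffs_polyPrim {d : ℕ} {pc : Fin d → ℂ} (hpc : ∀ k, IsAlgebraic ℚ (pc k)) :
    HasAlgCoeffs (polyPrim pc) := by
  refine hasAlgCoeffs_finsetSum _ _ fun k _ => ?_
  have h1 : IsAlgebraic ℚ (((k : ℕ) : ℂ) + 1) := by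
    have h := isAlgebraic_nat (R := ℚ) (A := ℂ) ((k : ℕ) + 1)
    simpa using h
  have h2 : IsAlgebraic ℚ (pc k / (((k : ℕ) : ℂ) + 1)) := by
    rw [div_eq_mul_inv]; exact (hpc k).mul h1.inv
  exact (hasAlgCoeffs_C h2).mul ((hasAlgCoeffs_X 0).pow ((k : ℕ) + 1))

/-- The sum of the polar parts has algebraic coefficients. [folklore] -/
theorem hasAlgCoeffs_polarPart {a : Fin r → ℂ} (ha : ∀ i, IsAlgebraic ℚ (a i)) {rc : Fin r → ℂ}
    (hrc : ∀ i, IsAlgebraic ℚ (rc i)) : ∀ k, HasAlgCoeffs ((∑ i, rc i •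
      (![X 1 * ∏ j ∈ Finset.univ.erase i, (X 0 - C (a j)), 0] :
        Fin 2 → MvPolynomial (Fin 2) ℂ)) k) :=
  fun k => hasAlgCoeffs_sum_apply _ _ (fun i k => (hasAlgCoeffs_basicForm ha i k).smul (hrc i)) k

/-- The input form has algebraic coefficients. [folklore] -/
theorem hasAlgCoeffs_inputForm {a : Fin r → ℂ} (ha : ∀ i, IsAlgebraic ℚ (a i)) {rc : Fin r → ℂ}
    (hrc : ∀ i, IsAlgebraic ℚ (rc i)) {d : ℕ} {pc : Fin d → ℂ} (hpc : ∀ k, IsAlgebraic ℚ (pc k)) :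
    ∀ k, HasAlgCoeffs (inputForm a rc pc k) :=
  fun k => (hasAlgCoeffs_polarPart ha hrc k).add ((hasAlgCoeffs_polyPrim hpc).formD k)

/-! ### Segment paths on `Z_a` -/

/-- **The segment `[z₀, z₁]` missing the `aᵢ` is a `C¹` path on `Z_a`** with algebraic end points
(`x(t) = z₀ + t (z₁ − z₀)`, `y = 1/∏ᵢ (x − aᵢ)`). [folklore] -/
theorem exists_segPath {a : Fin r → ℂ} (ha : ∀ i, IsAlgebraic ℚ (a i)) {z₀ z₁ : ℂ}
    (hz₀ : IsAlgebraic ℚ z₀) (hz₁ : IsAlgebraic ℚ z₁)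
    (hsep : ∀ i, ∀ t ∈ Icc (0 : ℝ) 1, z₀ + (t : ℂ) * (z₁ - z₀) ≠ a i) :
    ∃ γ : CurvePath (ZP a), ∀ t, γ.toFun t =
      ![z₀ + t * (z₁ - z₀), (∏ i, (z₀ + t * (z₁ - z₀) - a i))⁻¹] := by
  have hx : ContDiff ℝ 1 fun t : ℝ => z₀ + (t : ℂ) * (z₁ - z₀) :=
    contDiff_const.add (ofRealCLM.contDiff.mul contDiff_const)
  have hprod : ContDiffOn ℝ 1 (fun t : ℝ => ∏ i, (z₀ + (t : ℂ) * (z₁ - z₀) - a i)) (Icc 0 1) :=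
    contDiffOn_prod fun i _ => (hx.sub contDiff_const).contDiffOn
  have hne : ∀ t ∈ Icc (0 : ℝ) 1, ∏ i, (z₀ + (t : ℂ) * (z₁ - z₀) - a i) ≠ 0 := fun t ht =>
    Finset.prod_ne_zero_iff.2 fun i _ => sub_ne_zero.2 (hsep i t ht)
  refine ⟨{ toFun := fun t => ![z₀ + t * (z₁ - z₀), (∏ i, (z₀ + t * (z₁ - z₀) - a i))⁻¹]
            contDiffOn := ?_
            mem_points := ?_
            algebraic_zero := ?_
            algebraic_one := ?_ }, fun t => rfl⟩
  · refine contDiffOn_pi.2 fun i => ?_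
    fin_cases i
    · simpa using hx.contDiffOn
    · exact (hprod.inv hne).congr fun t _ => by simp
  · intro t ht
    rw [mem_points_puncturedLine_iff]
    simp only [Matrix.cons_val_one, Matrix.cons_val_zero, Matrix.cons_val_fin_one]
    exact inv_mul_cancel₀ (hne t ht)
  · intro i
    fin_cases i
    · simpa using hz₀
    · simpa using (isAlgebraic_finsetProd _ _ fun i _ => hz₀.sub (ha i)).inv
  · intro i
    fin_cases i
    · simpa using hz₁
    · have e : ∀ i, z₀ + (1 : ℂ) * (z₁ - z₀) - a i = z₁ - a i := fun i => by ring
      simpa [e] using (isAlgebraic_finsetProd _ _ fun i _ => hz₁.sub (ha i)).inv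

/-- **A point `c` is not on the segment `[z₀, z₁]`** as soon as, with `v = c − z₀`, `δ = z₁ − z₀`,
`s = v · conj δ`: `im s ≠ 0`, or `re s < 0`, or `re s > |δ|²` (exact test in `K`). [folklore] -/
theorem not_mem_segment {z₀ z₁ c : ℂ}
    (h : ((c - z₀) * (starRingEnd ℂ) (z₁ - z₀)).im ≠ 0 ∨ ((c - z₀) * (starRingEnd ℂ) (z₁ - z₀)).re < 0 ∨
      Complex.normSq (z₁ - z₀) < ((c - z₀) * (starRingEnd ℂ) (z₁ - z₀)).re) :
    ∀ t ∈ Icc (0 : ℝ) 1, z₀ + (t : ℂ) * (z₁ - z₀) ≠ c := by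
  intro t ht heq
  have hv : c - z₀ = (t : ℂ) * (z₁ - z₀) := by rw [← heq]; ring
  have hs : (c - z₀) * (starRingEnd ℂ) (z₁ - z₀) = (t * Complex.normSq (z₁ - z₀) : ℝ) := by
    rw [hv, mul_assoc, Complex.mul_conj]; push_cast; ring
  rw [hs, Complex.ofReal_im, Complex.ofReal_re] at h
  rcases h with h | h | h
  · exact h rfl
  · exact absurd h (not_lt.2 (mul_nonneg ht.1 (Complex.normSq_nonneg _)))
  · have : t * Complex.normSq (z₁ - z₀) ≤ 1 * Complex.normSq (z₁ - z₀) :=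
      mul_le_mul_of_nonneg_right ht.2 (Complex.normSq_nonneg _)
    linarith

/-- Real-coordinate form of `not_mem_segment` (`z₀ = x₀ + i y₀`, …), decidable by `norm_num` over
`ℚ` and by `nlinarith` with `√d` facts over quadratic fields. [folklore] -/
theorem not_mem_segment_re_im {x₀ y₀ x₁ y₁ u v : ℝ}
    (h : (v - y₀) * (x₁ - x₀) ≠ (u - x₀) * (y₁ - y₀) ∨
      (u - x₀) * (x₁ - x₀) + (v - y₀) * (y₁ - y₀) < 0 ∨
      (x₁ - x₀) ^ 2 + (y₁ - y₀) ^ 2 < (u - x₀) * (x₁ - x₀) + (v - y₀) * (y₁ - y₀)) :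
    ∀ t ∈ Icc (0 : ℝ) 1, (⟨x₀, y₀⟩ : ℂ) + (t : ℂ) * (⟨x₁, y₁⟩ - ⟨x₀, y₀⟩) ≠ ⟨u, v⟩ := by
  refine not_mem_segment ?_
  have hre : (((⟨u, v⟩ : ℂ) - ⟨x₀, y₀⟩) * (starRingEnd ℂ) (⟨x₁, y₁⟩ - ⟨x₀, y₀⟩)).re =
      (u - x₀) * (x₁ - x₀) + (v - y₀) * (y₁ - y₀) := by
    simp [Complex.mul_re, Complex.conj_re, Complex.conj_im]; ring
  have him : (((⟨u, v⟩ : ℂ) - ⟨x₀, y₀⟩) * (starRingEnd ℂ) (⟨x₁, y₁⟩ - ⟨x₀, y₀⟩)).im =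
      (v - y₀) * (x₁ - x₀) - (u - x₀) * (y₁ - y₀) := by
    simp [Complex.mul_im, Complex.conj_re, Complex.conj_im]; ring
  have hn : Complex.normSq ((⟨x₁, y₁⟩ : ℂ) - ⟨x₀, y₀⟩) = (x₁ - x₀) ^ 2 + (y₁ - y₀) ^ 2 := by
    simp [Complex.normSq_apply]; ring
  rw [hre, him, hn]
  rcases h with h | h | h
  · exact Or.inl (sub_ne_zero.2 h)
  · exact Or.inr (Or.inl h)
  · exact Or.inr (Or.inr h)

/-! ### Reduction of a segment symbol on `Z_a` to logarithm symbols -/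

/-- **kz1p moves (R1)+(R3)+(R4)+(A-hom) for one segment symbol.** For the input form
`ω = Σ_c r_c dx/(x − a_c) + p(x) dx` on `Z_a` and the segment `γ = [z₀, z₁]` (missing the `a_c`),
with `w_c (z₀ − a_c) = z₁ − a_c`, `w_c ∉ (−∞, 0]`:
`(Z_a, ω, γ) ∼ Σ_c r_c ℓ(Log w_c) + (P(z₁) − P(z₀)) · 𝟙` modulo the `ℚ̄`-span of the elementary
relations. [cite: HuberWustholz2022, §13.1 (A)–(B) (p. 120), §3.3.1 (pp. 42–43)] -/
theorem span_segmentSymbol {a : Fin r → ℂ} (ha : ∀ i, IsAlgebraic ℚ (a i)) {rc : Fin r → ℂ}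
    (hrc : ∀ i, IsAlgebraic ℚ (rc i)) {d : ℕ} {pc : Fin d → ℂ} (hpc : ∀ k, IsAlgebraic ℚ (pc k))
    {z₀ z₁ : ℂ} (hz₀ : IsAlgebraic ℚ z₀) (γ : CurvePath (ZP a))
    (hγ : ∀ t ∈ Icc (0 : ℝ) 1, γ.toFun t = ![z₀ + t * (z₁ - z₀), (∏ i, (z₀ + t * (z₁ - z₀) - a i))⁻¹])
    (w : Fin r → ℂ) (hw : ∀ i, w i * (z₀ - a i) = z₁ - a i) (hslit : ∀ i, w i ∈ slitPlane)
    (E : Fin r → CurvePath 𝔾m)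
    (hE : ∀ i t, (E i).toFun t =
      ![exp ((1 - t) * 0 + t * log (w i)), exp (-((1 - t) * 0 + t * log (w i)))]) :
    InSpanRel (Finsupp.single (⟨ZP a, isSmoothAffineCurve_puncturedLine ha, inputForm a rc pc,
        hasAlgCoeffs_inputForm ha hrc hpc, γ⟩ : PeriodSymbol) (1 : ℂ) -
      ∑ i, rc i • Finsupp.single (logSym (E i)) (1 : ℂ) -
      (polyPrimVal pc z₁ - polyPrimVal pc z₀) • Finsupp.single PeriodSymbol.unit (1 : ℂ)) := by
  classical
  have hZ : (ZP a).IsSmoothAffineCurve := isSmoothAffineCurve_puncturedLine ha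
  have h0I : (0 : ℝ) ∈ Icc (0 : ℝ) 1 := ⟨le_rfl, zero_le_one⟩
  have h1I : (1 : ℝ) ∈ Icc (0 : ℝ) 1 := ⟨zero_le_one, le_rfl⟩
  have hγ0 : γ.toFun 0 0 = z₀ := by rw [hγ 0 h0I]; simp
  have hγ1 : γ.toFun 1 0 = z₁ := by rw [hγ 1 h1I]; simp
  -- no `aᵢ` at the start point
  have hp0 : ∀ i, z₀ - a i ≠ 0 := by
    have hm := (mem_points_puncturedLine_iff a _).1 (γ.mem_points 0 h0I)
    rw [hγ0] at hm
    intro i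
    have hpr : ∏ j, (z₀ - a j) ≠ 0 := fun h => by rw [h, mul_zero] at hm; exact zero_ne_one hm
    exact (Finset.prod_ne_zero_iff.1 hpr) i (Finset.mem_univ i)
  -- the forms
  have hb := hasAlgCoeffs_basicForm ha
  have hS := hasAlgCoeffs_polarPart ha hrc
  have hQ := hasAlgCoeffs_polyPrim hpc
  have hdQ : ∀ k, HasAlgCoeffs (formD (polyPrim pc) k) := hQ.formD
  -- (R1): split off the exact part, then the polar parts
  have r₂ := IsElementaryRelation.add _ hZ γ (inputForm a rc pc) _ _ (hasAlgCoeffs_inputForm ha hrc hpc)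
    hS hdQ rfl
  have r₃ := span_single_sum_smul (ZP a) hZ γ Finset.univ _ hb rc hrc hS
  -- (R3): the exact part
  have r₄ := IsElementaryRelation.exact _ hZ γ (polyPrim pc) hQ _ hdQ rfl
  have hval : eval (γ.toFun 1) (polyPrim pc) - eval (γ.toFun 0) (polyPrim pc) =
      polyPrimVal pc z₁ - polyPrimVal pc z₀ := by rw [eval_polyPrim, eval_polyPrim, hγ0, hγ1]
  -- (R4) along `f_c`, then the segment on `𝔾ₘ` is a logarithm symbol
  have hseg : ∀ i, InSpanRel (Finsupp.single (⟨ZP a, hZ,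
      ![X 1 * ∏ j ∈ Finset.univ.erase i, (X 0 - C (a j)), 0], hb i, γ⟩ : PeriodSymbol) (1 : ℂ) -
      Finsupp.single (logSym (E i)) (1 : ℂ)) := by
    intro i
    obtain ⟨γ', hγ', hrel⟩ := exists_rel_basicForm_mulGroup ha i γ
    have hγ'0 : ∀ t ∈ Icc (0 : ℝ) 1, γ'.toFun t 0 = (z₀ - a i) + t * ((z₁ - a i) - (z₀ - a i)) := by
      intro t ht
      rw [hγ', hγ t ht]
      simp only [Matrix.cons_val_zero]
      ring
    have hs := span_segment_logSym (hz₀.sub (ha i)) (hp0 i) (hw i) (hslit i) γ' hγ'0 (E i) (hE i)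
    obtain ⟨k, ρ, c, hρ, hc, hsum⟩ := span_add (span_of_rel hrel) hs
    exact ⟨k, ρ, c, hρ, hc, by rw [← hsum]; abel⟩
  have r₆ : InSpanRel (∑ i, rc i • (Finsupp.single (⟨ZP a, hZ,
      ![X 1 * ∏ j ∈ Finset.univ.erase i, (X 0 - C (a j)), 0], hb i, γ⟩ : PeriodSymbol) (1 : ℂ) -
      Finsupp.single (logSym (E i)) (1 : ℂ))) :=
    span_finsetSum _ _ fun i _ => span_smul (hrc i) (hseg i)
  obtain ⟨k, ρ, cf, hρ, hcf, hsum⟩ := span_add (span_add (span_add (span_of_rel r₂) r₃)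
    (span_of_rel r₄)) r₆
  refine ⟨k, ρ, cf, hρ, hcf, ?_⟩
  rw [← hval, ← hsum]
  simp only [smul_sub, Finset.sum_sub_distrib]
  abel

end InputForms

end Summit.KontsevichZagierPeriods.KzOnePeriods.G0Derivation

end
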